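import Mathlib

/-!
# Support count of two sides from their sum and difference (§3g COUNT)

Helper for the crux stmt-ValiantsHypothesis-7391 (negative lane; `Cruxes/PeelingLemma/DETERMINISTIC-ALLX.md`
§3g COUNT / §3h (E2)).  For integer-valued functions `S₁, S₂` on a finite set `T` of letters:
pointwise `[S₁ ≠ 0] + [S₂ ≠ 0] ≥ [S₁ + S₂ ≠ 0] + 2·[S₁ + S₂ = 0 ∧ S₁ - S₂ ≠ 0]`, hence
`#supp S₁ + #supp S₂ ≥ #supp (S₁+S₂) + 2 · #(supp (S₁-S₂) ∖ supp (S₁+S₂))` (`card_support_sides_ge`).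
In the local lemma [E] this confines a would-be violation (total support `≤ 3`) to one spider of
the local sum `S⁺` and puts the support of `S⁻` inside it.  Pure finite counting; no Theses import.
-/

namespace Summit.ValiantsHypothesis.ValiantsHypothesis.Theorems.PeelingLemmaWindow

-- summit = sub-problem name (single-conjunct summit, D-0017 layout), so the namespace repeats it
set_option linter.dupNamespace false

open scoped BigOperators
open Finset

variable {Λ : Type*}

/-- Pointwise indicator inequality behind the count. -/
theorem indicator_sides_ge (x y : ℤ) :
    (if x + y ≠ 0 then (1 : ℕ) else 0) + 2 * (if x + y = 0 ∧ x - y ≠ 0 then 1 else 0) ≤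
      (if x ≠ 0 then 1 else 0) + (if y ≠ 0 then 1 else 0) := by
  split_ifs <;> omega

/-- **Support count.**  `#supp(S₁+S₂) + 2·#(supp(S₁-S₂) ∖ supp(S₁+S₂)) ≤ #supp S₁ + #supp S₂` on any
finite set `T`. -/
theorem card_support_sides_ge [DecidableEq Λ] (T : Finset Λ) (S₁ S₂ : Λ → ℤ) :
    (T.filter (fun ν => S₁ ν + S₂ ν ≠ 0)).card +
        2 * (T.filter (fun ν => S₁ ν + S₂ ν = 0 ∧ S₁ ν - S₂ ν ≠ 0)).card ≤
      (T.filter (fun ν => S₁ ν ≠ 0)).card + (T.filter (fun ν => S₂ ν ≠ 0)).card := by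
  classical
  simp only [Finset.card_filter, Finset.mul_sum]
  rw [← Finset.sum_add_distrib, ← Finset.sum_add_distrib]
  exact Finset.sum_le_sum fun ν _ => indicator_sides_ge (S₁ ν) (S₂ ν)

/-- The form used in [E]: if the two sides have total support `≤ 3` and the sum `S₁+S₂` has at least
two support letters in `T`, then `S₁ - S₂` vanishes wherever `S₁ + S₂` does (inside `T`), and
`S₁ + S₂` has at most three support letters. -/
theorem sub_support_subset_of_le_three [DecidableEq Λ] (T : Finset Λ) (S₁ S₂ : Λ → ℤ)
    (h3 : (T.filter (fun ν => S₁ ν ≠ 0)).card + (T.filter (fun ν => S₂ ν ≠ 0)).card ≤ 3)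
    (h2 : 2 ≤ (T.filter (fun ν => S₁ ν + S₂ ν ≠ 0)).card) :
    (∀ ν ∈ T, S₁ ν + S₂ ν = 0 → S₁ ν - S₂ ν = 0) ∧
      (T.filter (fun ν => S₁ ν + S₂ ν ≠ 0)).card ≤ 3 := by
  have h := card_support_sides_ge T S₁ S₂
  refine ⟨fun ν hν h0 => ?_, by omega⟩
  by_contra hne
  have : 1 ≤ (T.filter (fun ν => S₁ ν + S₂ ν = 0 ∧ S₁ ν - S₂ ν ≠ 0)).card :=
    Finset.card_pos.mpr ⟨ν, Finset.mem_filter.mpr ⟨hν, h0, hne⟩⟩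
  omega

end Summit.ValiantsHypothesis.ValiantsHypothesis.Theorems.PeelingLemmaWindow
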